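import Mathlib
import Literature.Geometry.Symplectic.JHolomorphicMap
import Summits.SmoothPoincare4.SmoothPoincare4.Theorems.SullivanDualTameOrBrodyR4PencilDefs
import Summits.SmoothPoincare4.SmoothPoincare4.Theorems.SullivanDualTameOrBrodyR4ContinuityEstimates
import Summits.SmoothPoincare4.SmoothPoincare4.Theorems.SullivanDualTameOrBrodyR4HelperFarMemberFlat
import Summits.SmoothPoincare4.SmoothPoincare4.Theorems.SullivanDualTameOrBrodyR4StubCompactnessLoc

/-!
# Uniform tails and `C^{1,r}`-convergence of pencil members (stub `helper_memberTails`, line Sketch)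

Crux `stmt-SmoothPoincare4-7826` (`TameOrBrodyR4`), line `Sketch`, in the vocabulary of
`Theorems/SullivanDualTameOrBrodyR4PencilDefs.lean`: `J` on `ℝ⁴` is standard (`= i` in the frame
`(P, Q)`) where `‖x‖ ≥ R`; `u₀` is a normalised member of the pencil in direction `P` with
asymptotic value `b₀`, and `w n` are members with values `b n → b₀` converging to `u₀` locally
uniformly on `ℂ` together with their first derivatives. Then the convergence upgrades to

* UNIFORM `C⁰`-convergence on all of `ℂ` (the tails of members are uniformly controlled), and
* `C^{1,r}`-convergence on every closed disc, `0 < r < 1`.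

Proof.

* Far tails. If `‖b₀‖ > R`, then eventually `‖b n‖ > R` and the members ARE the flat planes
  `ξ ↦ eP ξ + eQ b` (`helper_farMemberFlat`), so `w n - u₀ = eQ (b n - b₀)` is a small constant.
  If `‖b₀‖ < 2R`, then eventually `‖b n‖ < 2R` and the normalisation estimates
  `helper_memberEstimates` (`|P (u ξ) - ξ| ≤ 120R²/|ξ|`, `|Q (u ξ) - b| ≤ 16R²/|P (u ξ)|`) give,
  for `‖ξ‖ ≥ L ≥ 20R`, `‖w n ξ - u₀ ξ‖ ≤ 304R²/L + |b n - b₀|` (`MemberTails.far_diff`); on the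
  disc `‖ξ‖ ≤ L` the locally uniform convergence is uniform.
* `C¹` on the disc: locally uniform convergence of the derivatives, read on the compact disc.
* Hölder seminorm on the disc: the rescaled interior a-priori estimate
  (`CompactnessLoc.norm_iteratedFDeriv_le`, from `BlowUp.apriori_estimate`) bounds `D²(w n)`
  on the disc uniformly in `n` (the `C⁰`/`C¹` bounds on every disc, uniformly in ALL `n`, come
  from the locally uniform convergence, `MemberTails.exists_forall_norm_le`), and `D²u₀` is
  bounded by continuity; so `φ n := D(w n) - Du₀` is `M`-Lipschitz on the (convex) disc and
  uniformly small, `‖φ n‖ ≤ η`, whence the interpolation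
  `‖φ n ξ - φ n ξ'‖ ≤ (M‖ξ - ξ'‖)^r (2η)^{1-r}` (`MemberTails.le_rpow_mul_rpow`), which is
  `≤ ε‖ξ - ξ'‖^r` once `(2η)^{1-r} = ε/M^r`.

References: M. Gromov, Invent. Math. 82 (1985), §2.4.A; D. McDuff, D. Salamon, *J-holomorphic
curves and symplectic topology*, 2nd ed. (2012), Thm B.4.2 (interior a-priori estimate).
-/

-- the registered namespace `Summit.SmoothPoincare4.SmoothPoincare4.…` repeats a component
set_option linter.dupNamespace false

noncomputable section

open scoped ContDiff NNReal Topology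
open Filter Set Metric Literature.Geometry.Symplectic

namespace Summit.SmoothPoincare4.SmoothPoincare4.Cruxes.TameOrBrodyR4.Sketch

/-- Local notation for the model space `ℝ⁴ = EuclideanSpace ℝ (Fin 4)`. -/
local notation "E4" => EuclideanSpace ℝ (Fin 4)

namespace MemberTails

/-- **Uniform bounds on discs from locally uniform convergence.** Continuous maps `F n : ℂ → X`
converging locally uniformly to a continuous `f` are bounded on every disc uniformly in ALL `n`
(tail: within `1` of the bounded limit; head: finitely many continuous maps). -/
theorem exists_forall_norm_le {X : Type*} [SeminormedAddCommGroup X] {F : ℕ → ℂ → X}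
    {f : ℂ → X} (hF : ∀ n, Continuous (F n)) (hf : Continuous f)
    (h : TendstoLocallyUniformly F f atTop) (ρ : ℝ) :
    ∃ C : ℝ, ∀ n (z : ℂ), ‖z‖ ≤ ρ → ‖F n z‖ ≤ C := by
  have hU : TendstoUniformlyOn F f atTop (closedBall (0 : ℂ) ρ) :=
    (tendstoLocallyUniformly_iff_forall_isCompact.1 h) _ (isCompact_closedBall _ _)
  obtain ⟨N, hN⟩ := eventually_atTop.1 ((Metric.tendstoUniformlyOn_iff.1 hU) 1 one_pos)
  obtain ⟨B, hB⟩ :=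
    (isCompact_closedBall (0 : ℂ) ρ).exists_bound_of_continuousOn hf.continuousOn
  have hhead : ∀ n, ∃ B' : ℝ, ∀ z ∈ closedBall (0 : ℂ) ρ, ‖F n z‖ ≤ B' := fun n =>
    (isCompact_closedBall (0 : ℂ) ρ).exists_bound_of_continuousOn (hF n).continuousOn
  choose B' hB' using hhead
  refine ⟨max (B + 1) (∑ i ∈ Finset.range N, |B' i|), fun n z hz => ?_⟩
  have hz' : z ∈ closedBall (0 : ℂ) ρ := mem_closedBall_zero_iff.2 hz
  rcases le_or_gt N n with hn | hn
  · have h1 := hN n hn z hz'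
    rw [dist_eq_norm] at h1
    have h2 := norm_sub_norm_le (F n z) (f z)
    rw [norm_sub_rev] at h2
    have h3 := hB z hz'
    exact le_trans (by linarith) (le_max_left _ _)
  · calc ‖F n z‖ ≤ B' n := hB' n z hz'
      _ ≤ |B' n| := le_abs_self _
      _ ≤ ∑ i ∈ Finset.range N, |B' i| :=
        Finset.single_le_sum (fun i _ => abs_nonneg (B' i)) (Finset.mem_range.2 hn)
      _ ≤ max (B + 1) (∑ i ∈ Finset.range N, |B' i|) := le_max_right _ _

/-- **Mean value inequality for the first derivative.** A `C^∞` map whose second derivative is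
bounded by `M` on a closed disc has `M`-Lipschitz first derivative there. -/
theorem norm_fderiv_sub_le {f : ℂ → E4} (hf : ContDiff ℝ ∞ f) {ρ M : ℝ}
    (hM : ∀ z ∈ closedBall (0 : ℂ) ρ, ‖iteratedFDeriv ℝ 2 f z‖ ≤ M) {ξ ξ' : ℂ}
    (hξ : ξ ∈ closedBall (0 : ℂ) ρ) (hξ' : ξ' ∈ closedBall (0 : ℂ) ρ) :
    ‖fderiv ℝ f ξ - fderiv ℝ f ξ'‖ ≤ M * ‖ξ - ξ'‖ := by
  have hd : ContDiff ℝ ∞ (fderiv ℝ f) := (contDiff_infty_iff_fderiv.1 hf).2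
  refine (convex_closedBall (0 : ℂ) ρ).norm_image_sub_le_of_norm_fderiv_le (𝕜 := ℝ)
    (fun x _ => (hd.differentiable (by simp)) x) (fun x hx => ?_) hξ' hξ
  rw [← norm_iteratedFDeriv_one (𝕜 := ℝ), norm_iteratedFDeriv_fderiv]
  exact hM x hx

/-- **Interpolation between a Lipschitz and a sup bound.** If `0 ≤ A ≤ a` and `A ≤ c`, then
`A ≤ a^r c^{1-r}` for `0 ≤ r ≤ 1`. -/
theorem le_rpow_mul_rpow {A a c r : ℝ} (hA : 0 ≤ A) (ha : A ≤ a) (hc : A ≤ c) (hr0 : 0 ≤ r)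
    (hr1 : r ≤ 1) : A ≤ a ^ r * c ^ (1 - r) := by
  have h1 : r + (1 - r) = 1 := by ring
  calc A = A ^ r * A ^ (1 - r) := by
        rw [← Real.rpow_add' hA (by rw [h1]; exact one_ne_zero), h1, Real.rpow_one]
    _ ≤ a ^ r * c ^ (1 - r) :=
        mul_le_mul (Real.rpow_le_rpow hA ha hr0) (Real.rpow_le_rpow hA hc (by linarith))
          (Real.rpow_nonneg hA _) (Real.rpow_nonneg (hA.trans ha) _)

/-- In a coordinate frame, `‖x‖ ≤ |P x| + |Q x|`. -/
theorem norm_le_norm_P_add {P Q : E4 →L[ℝ] ℂ} {eP eQ : ℂ →L[ℝ] E4} (h : IsCoordFrame P Q eP eQ)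
    (x : E4) : ‖x‖ ≤ ‖P x‖ + ‖Q x‖ :=
  le_of_pow_le_pow_left₀ two_ne_zero (by positivity)
    (by rw [h.1 x]; nlinarith [norm_nonneg (P x), norm_nonneg (Q x)])

/-- In a coordinate frame, `‖eQ c‖ ≤ |c|`. -/
theorem norm_eQ_le {P Q : E4 →L[ℝ] ℂ} {eP eQ : ℂ →L[ℝ] E4} (h : IsCoordFrame P Q eP eQ)
    (c : ℂ) : ‖eQ c‖ ≤ ‖c‖ :=
  le_of_pow_le_pow_left₀ two_ne_zero (norm_nonneg c)
    (by rw [h.1 (eQ c), h.2.2.2.1, h.2.2.2.2.1, norm_zero]; norm_num)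

/-- **Far tail of a non-honest member.** From the normalisation estimates (iv), (v) of
`helper_memberEstimates`: for `L ≥ 20R` and `‖ξ‖ ≥ L`, `|P (u ξ) - ξ| ≤ 120R²/L` and
`|Q (u ξ) - b| ≤ 32R²/L`. -/
theorem far_tail {R L : ℝ} {P Q : E4 →L[ℝ] ℂ} {b : ℂ} {u : ℂ → E4} (hR : 0 < R)
    (hL : 20 * R ≤ L)
    (hiv : ∀ ξ : ℂ, 6 * R ≤ ‖ξ‖ → ‖P (u ξ) - ξ‖ ≤ 120 * R ^ 2 / ‖ξ‖)
    (hv : ∀ ξ : ℂ, 4 * R ≤ ‖P (u ξ)‖ → ‖Q (u ξ) - b‖ ≤ 16 * R ^ 2 / ‖P (u ξ)‖)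
    {ξ : ℂ} (hξ : L ≤ ‖ξ‖) :
    ‖P (u ξ) - ξ‖ ≤ 120 * R ^ 2 / L ∧ ‖Q (u ξ) - b‖ ≤ 32 * R ^ 2 / L := by
  have hL0 : 0 < L := by linarith
  have hξ0 : 0 < ‖ξ‖ := by linarith
  have hP1 : ‖P (u ξ) - ξ‖ ≤ 120 * R ^ 2 / ‖ξ‖ := hiv ξ (by linarith)
  have hP2 : 120 * R ^ 2 / ‖ξ‖ ≤ 120 * R ^ 2 / L :=
    div_le_div_of_nonneg_left (by positivity) hL0 hξ
  have hP3 : 120 * R ^ 2 / ‖ξ‖ ≤ 6 * R := by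
    rw [div_le_iff₀ hξ0]
    nlinarith [hL.trans hξ]
  have hPlow : L / 2 ≤ ‖P (u ξ)‖ := by
    have h := norm_sub_norm_le ξ (P (u ξ))
    rw [norm_sub_rev] at h
    linarith
  have hQ1 := hv ξ (by linarith)
  have hQ2 : 16 * R ^ 2 / ‖P (u ξ)‖ ≤ 32 * R ^ 2 / L := by
    rw [div_le_div_iff₀ (by linarith) hL0]
    nlinarith [sq_nonneg R]
  exact ⟨hP1.trans hP2, hQ1.trans hQ2⟩

/-- **Two non-honest members are uniformly close far out.** For `L ≥ 20R` and `‖ξ‖ ≥ L`,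
`‖u ξ - u' ξ‖ ≤ 304R²/L + |b - b'|` (coordinatewise, by `far_tail`). -/
theorem far_diff {R L : ℝ} {P Q : E4 →L[ℝ] ℂ} {eP eQ : ℂ →L[ℝ] E4} (hPQ : IsCoordFrame P Q eP eQ)
    (hR : 0 < R) (hL : 20 * R ≤ L) {b b' : ℂ} {u u' : ℂ → E4}
    (hiv : ∀ ξ : ℂ, 6 * R ≤ ‖ξ‖ → ‖P (u ξ) - ξ‖ ≤ 120 * R ^ 2 / ‖ξ‖)
    (hv : ∀ ξ : ℂ, 4 * R ≤ ‖P (u ξ)‖ → ‖Q (u ξ) - b‖ ≤ 16 * R ^ 2 / ‖P (u ξ)‖)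
    (hiv' : ∀ ξ : ℂ, 6 * R ≤ ‖ξ‖ → ‖P (u' ξ) - ξ‖ ≤ 120 * R ^ 2 / ‖ξ‖)
    (hv' : ∀ ξ : ℂ, 4 * R ≤ ‖P (u' ξ)‖ → ‖Q (u' ξ) - b'‖ ≤ 16 * R ^ 2 / ‖P (u' ξ)‖)
    {ξ : ℂ} (hξ : L ≤ ‖ξ‖) : ‖u ξ - u' ξ‖ ≤ 304 * R ^ 2 / L + ‖b - b'‖ := by
  obtain ⟨hP, hQ⟩ := far_tail hR hL hiv hv hξ
  obtain ⟨hP', hQ'⟩ := far_tail hR hL hiv' hv' hξ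
  have e1 : ‖P (u ξ - u' ξ)‖ ≤ ‖P (u ξ) - ξ‖ + ‖P (u' ξ) - ξ‖ := by
    rw [map_sub, show P (u ξ) - P (u' ξ) = (P (u ξ) - ξ) - (P (u' ξ) - ξ) by ring]
    exact norm_sub_le _ _
  have e2 : ‖Q (u ξ - u' ξ)‖ ≤ ‖Q (u ξ) - b‖ + ‖b - b'‖ + ‖Q (u' ξ) - b'‖ := by
    rw [map_sub, show Q (u ξ) - Q (u' ξ) = (Q (u ξ) - b) + (b - b') - (Q (u' ξ) - b') by ring]
    exact (norm_sub_le _ _).trans (add_le_add (norm_add_le _ _) le_rfl)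
  have e3 := norm_le_norm_P_add hPQ (u ξ - u' ξ)
  have e4 : 120 * R ^ 2 / L + 120 * R ^ 2 / L + (32 * R ^ 2 / L + 32 * R ^ 2 / L) =
      304 * R ^ 2 / L := by ring
  linarith

end MemberTails

/-- (TAIL) `C¹_loc`-convergence of members `w n → u₀` (asymptotic values `b n → b₀`) upgrades to
uniform `C⁰`-convergence on `ℂ` (uniform tails of members: far members are flat,
`helper_farMemberFlat`; non-honest members satisfy the normalisation estimates
`helper_memberEstimates`) and to `C^{1,r}`-convergence on every closed disc (uniform `C²` bounds
from the interior a-priori estimate, then interpolation between the Lipschitz and the sup bound of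
`D(w n) - Du₀`). -/
theorem helper_memberTails (J : E4 → E4 →L[ℝ] E4) (R : ℝ) (P Q : E4 →L[ℝ] ℂ) (eP eQ : ℂ →L[ℝ] E4)
    (hR : 0 < R) (hJs : ContDiff ℝ ∞ J) (hJ2 : ∀ x v, J x (J x v) = -v)
    (hPQ : IsCoordFrame P Q eP eQ)
    (hJP : ∀ x : E4, R ≤ ‖x‖ → ∀ v, P (J x v) = Complex.I * P v)
    (hJQ : ∀ x : E4, R ≤ ‖x‖ → ∀ v, Q (J x v) = Complex.I * Q v) {r : ℝ≥0} (hr : 0 < r)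
    (hr1 : r < 1) (b₀ : ℂ) (u₀ : ℂ → E4) (hu₀ : IsPencilMember J R P Q b₀ u₀) (b : ℕ → ℂ)
    (w : ℕ → ℂ → E4) (hw : ∀ n, IsPencilMember J R P Q (b n) (w n))
    (hb : Tendsto b atTop (𝓝 b₀)) (h0 : TendstoLocallyUniformly w u₀ atTop)
    (h1 : TendstoLocallyUniformly (fun n => fderiv ℝ (w n)) (fderiv ℝ u₀) atTop) (ρ ε : ℝ)
    (hρ : 0 < ρ) (hε : 0 < ε) :
    ∀ᶠ n in atTop, (∀ ξ : ℂ, ‖w n ξ - u₀ ξ‖ ≤ ε) ∧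
      (∀ ξ ∈ Metric.closedBall (0 : ℂ) ρ, ‖fderiv ℝ (w n) ξ - fderiv ℝ u₀ ξ‖ ≤ ε) ∧
      (∀ ξ ∈ Metric.closedBall (0 : ℂ) ρ, ∀ ξ' ∈ Metric.closedBall (0 : ℂ) ρ,
        ‖(fderiv ℝ (w n) ξ - fderiv ℝ u₀ ξ) - (fderiv ℝ (w n) ξ' - fderiv ℝ u₀ ξ')‖ ≤
          ε * ‖ξ - ξ'‖ ^ (r : ℝ)) := by
  -- `hr` and `hρ` are not needed below
  have _ := hr
  have _ := hρ
  have hws : ∀ n, ContDiff ℝ ∞ (w n) := fun n => (hw n).1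
  have hwJ : ∀ n, IsJHolomorphicFlat J (w n) := fun n => (hw n).2.1
  have hu₀s : ContDiff ℝ ∞ u₀ := hu₀.1
  /- (i) uniform `C⁰`-convergence on `ℂ` -/
  have hfirst : ∀ᶠ n in atTop, ∀ ξ : ℂ, ‖w n ξ - u₀ ξ‖ ≤ ε := by
    rcases lt_or_ge R ‖b₀‖ with hfar | hnear
    · -- far values: the members are the flat planes
      have hu₀flat := helper_farMemberFlat J R P Q eP eQ hR hPQ hJP hJQ b₀ hfar u₀ hu₀
      have hevb : ∀ᶠ n in atTop, R < ‖b n‖ := hb.norm.eventually (lt_mem_nhds hfar)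
      have hevε : ∀ᶠ n in atTop, dist (b n) b₀ < ε := Metric.tendsto_nhds.1 hb ε hε
      filter_upwards [hevb, hevε] with n hn1 hn2
      have hwn := helper_farMemberFlat J R P Q eP eQ hR hPQ hJP hJQ (b n) hn1 (w n) (hw n)
      intro ξ
      rw [show w n ξ = eP ξ + eQ (b n) from congrFun hwn ξ,
        show u₀ ξ = eP ξ + eQ b₀ from congrFun hu₀flat ξ,
        show eP ξ + eQ (b n) - (eP ξ + eQ b₀) = eQ (b n - b₀) by rw [map_sub]; abel]
      rw [dist_eq_norm] at hn2
      exact (MemberTails.norm_eQ_le hPQ _).trans hn2.le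
    · -- non-honest values: normalisation estimates far out, locally uniform convergence inside
      have hb2 : ‖b₀‖ < 2 * R := by linarith
      have hest₀ := helper_memberEstimates J R P Q eP eQ hR hPQ hJP hJQ hu₀ hb2
      obtain ⟨L, hL20, hLε⟩ : ∃ L : ℝ, 20 * R ≤ L ∧ 608 * R ^ 2 / ε ≤ L :=
        ⟨max (20 * R) (608 * R ^ 2 / ε), le_max_left _ _, le_max_right _ _⟩
      have hL0 : 0 < L := by linarith
      have hLε' : 304 * R ^ 2 / L ≤ ε / 2 := by
        rw [div_le_iff₀ hε] at hLε
        rw [div_le_iff₀ hL0]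
        nlinarith
      have hevb : ∀ᶠ n in atTop, ‖b n‖ < 2 * R := hb.norm.eventually (gt_mem_nhds hb2)
      have hevε : ∀ᶠ n in atTop, dist (b n) b₀ < ε / 2 :=
        Metric.tendsto_nhds.1 hb _ (half_pos hε)
      have hevK : ∀ᶠ n in atTop, ∀ ξ ∈ closedBall (0 : ℂ) L, dist (u₀ ξ) (w n ξ) < ε :=
        Metric.tendstoUniformlyOn_iff.1 ((tendstoLocallyUniformly_iff_forall_isCompact.1 h0)
          _ (isCompact_closedBall _ _)) ε hε
      filter_upwards [hevb, hevε, hevK] with n hn1 hn2 hn3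
      intro ξ
      rcases le_or_gt ‖ξ‖ L with hξ | hξ
      · have h := hn3 ξ (mem_closedBall_zero_iff.2 hξ)
        rw [dist_comm, dist_eq_norm] at h
        exact h.le
      · have hestn := helper_memberEstimates J R P Q eP eQ hR hPQ hJP hJQ (hw n) hn1
        have key := MemberTails.far_diff hPQ hR hL20 hestn.2.2.2.1 hestn.2.2.2.2.1
          hest₀.2.2.2.1 hest₀.2.2.2.2.1 hξ.le
        rw [dist_eq_norm] at hn2
        linarith
  /- (ii) `C¹`-convergence on the disc -/
  have hU1 : TendstoUniformlyOn (fun n => fderiv ℝ (w n)) (fderiv ℝ u₀) atTop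
      (closedBall (0 : ℂ) ρ) :=
    (tendstoLocallyUniformly_iff_forall_isCompact.1 h1) _ (isCompact_closedBall _ _)
  have hsecond : ∀ᶠ n in atTop, ∀ ξ ∈ Metric.closedBall (0 : ℂ) ρ,
      ‖fderiv ℝ (w n) ξ - fderiv ℝ u₀ ξ‖ ≤ ε := by
    filter_upwards [Metric.tendstoUniformlyOn_iff.1 hU1 ε hε] with n hn ξ hξ
    have h := hn ξ hξ
    rw [dist_comm, dist_eq_norm] at h
    exact h.le
  /- (iii) Hölder seminorm on the disc: uniform `C²` bounds and interpolation -/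
  have hKb : ∀ ρ' : ℝ, ∃ C : ℝ, ∀ n (z : ℂ), ‖z‖ ≤ ρ' → ‖w n z‖ ≤ C := fun ρ' =>
    MemberTails.exists_forall_norm_le (fun n => (hws n).continuous) hu₀s.continuous h0 ρ'
  have hDb : ∀ ρ' : ℝ, ∃ M : ℝ, ∀ n (z : ℂ), ‖z‖ ≤ ρ' → ‖fderiv ℝ (w n) z‖ ≤ M := fun ρ' =>
    MemberTails.exists_forall_norm_le (fun n => (hws n).continuous_fderiv (by simp))
      (hu₀s.continuous_fderiv (by simp)) h1 ρ'
  obtain ⟨C₁, hC₁⟩ := CompactnessLoc.norm_iteratedFDeriv_le J hJs hJ2 w hws hwJ hKb hDb 2 ρ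
  obtain ⟨C₀, hC₀⟩ := (isCompact_closedBall (0 : ℂ) ρ).exists_bound_of_continuousOn
    ((hu₀s.continuous_iteratedFDeriv (m := 2) (by norm_cast)).continuousOn)
  obtain ⟨M, hM1, hMC⟩ : ∃ M : ℝ, 1 ≤ M ∧ C₁ + C₀ ≤ M :=
    ⟨max 1 (C₁ + C₀), le_max_left _ _, le_max_right _ _⟩
  have hM0 : 0 < M := one_pos.trans_le hM1
  have hLip : ∀ n, ∀ ξ ∈ closedBall (0 : ℂ) ρ, ∀ ξ' ∈ closedBall (0 : ℂ) ρ,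
      ‖(fderiv ℝ (w n) ξ - fderiv ℝ u₀ ξ) - (fderiv ℝ (w n) ξ' - fderiv ℝ u₀ ξ')‖ ≤
        M * ‖ξ - ξ'‖ := by
    intro n ξ hξ ξ' hξ'
    have e1 := MemberTails.norm_fderiv_sub_le (hws n) (hC₁ n) hξ hξ'
    have e2 := MemberTails.norm_fderiv_sub_le hu₀s hC₀ hξ hξ'
    rw [show (fderiv ℝ (w n) ξ - fderiv ℝ u₀ ξ) - (fderiv ℝ (w n) ξ' - fderiv ℝ u₀ ξ') =
      (fderiv ℝ (w n) ξ - fderiv ℝ (w n) ξ') - (fderiv ℝ u₀ ξ - fderiv ℝ u₀ ξ') by abel]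
    calc _ ≤ ‖fderiv ℝ (w n) ξ - fderiv ℝ (w n) ξ'‖ + ‖fderiv ℝ u₀ ξ - fderiv ℝ u₀ ξ'‖ :=
          norm_sub_le _ _
      _ ≤ C₁ * ‖ξ - ξ'‖ + C₀ * ‖ξ - ξ'‖ := add_le_add e1 e2
      _ = (C₁ + C₀) * ‖ξ - ξ'‖ := by ring
      _ ≤ M * ‖ξ - ξ'‖ := mul_le_mul_of_nonneg_right hMC (norm_nonneg _)
  have hr0 : (0 : ℝ) ≤ r := r.coe_nonneg
  have hr1' : (r : ℝ) < 1 := by exact_mod_cast hr1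
  have h1r : 0 < 1 - (r : ℝ) := sub_pos.2 hr1'
  have hMr : 0 < M ^ (r : ℝ) := Real.rpow_pos_of_pos hM0 _
  obtain ⟨X, hXdef⟩ : ∃ X : ℝ, X = (ε / M ^ (r : ℝ)) ^ (1 - (r : ℝ))⁻¹ := ⟨_, rfl⟩
  have hX0 : 0 < X := by rw [hXdef]; exact Real.rpow_pos_of_pos (div_pos hε hMr) _
  have hXpow : X ^ (1 - (r : ℝ)) = ε / M ^ (r : ℝ) := by
    rw [hXdef]; exact Real.rpow_inv_rpow (div_pos hε hMr).le h1r.ne'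
  have hthird : ∀ᶠ n in atTop, ∀ ξ ∈ Metric.closedBall (0 : ℂ) ρ,
      ∀ ξ' ∈ Metric.closedBall (0 : ℂ) ρ,
        ‖(fderiv ℝ (w n) ξ - fderiv ℝ u₀ ξ) - (fderiv ℝ (w n) ξ' - fderiv ℝ u₀ ξ')‖ ≤
          ε * ‖ξ - ξ'‖ ^ (r : ℝ) := by
    filter_upwards [Metric.tendstoUniformlyOn_iff.1 hU1 _ (half_pos hX0)] with n hn ξ hξ ξ' hξ'
    have hA2 : ‖(fderiv ℝ (w n) ξ - fderiv ℝ u₀ ξ) - (fderiv ℝ (w n) ξ' - fderiv ℝ u₀ ξ')‖ ≤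
        X := by
      have a := hn ξ hξ
      have a' := hn ξ' hξ'
      rw [dist_comm, dist_eq_norm] at a a'
      calc _ ≤ ‖fderiv ℝ (w n) ξ - fderiv ℝ u₀ ξ‖ + ‖fderiv ℝ (w n) ξ' - fderiv ℝ u₀ ξ'‖ :=
            norm_sub_le _ _
        _ ≤ X := by linarith
    calc _ ≤ (M * ‖ξ - ξ'‖) ^ (r : ℝ) * X ^ (1 - (r : ℝ)) :=
          MemberTails.le_rpow_mul_rpow (norm_nonneg _) (hLip n ξ hξ ξ' hξ') hA2 hr0 hr1'.le
      _ = ε * ‖ξ - ξ'‖ ^ (r : ℝ) := by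
          rw [Real.mul_rpow hM0.le (norm_nonneg _), hXpow]
          field_simp
  filter_upwards [hfirst, hsecond, hthird] with n h₁ h₂ h₃
  exact ⟨h₁, h₂, h₃⟩

end Summit.SmoothPoincare4.SmoothPoincare4.Cruxes.TameOrBrodyR4.Sketch
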